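import Literature.RepresentationTheory.CompactGroups.WeylIntegrationUnitary

/-!
# Weyl's integral formula for `U(n)`, file 9: THE PUSHFORWARD FORM — conjugation maps
# `Haar_{U(n)} ⊗ (|Δ|²/n!)·Haar_{Δ(n)}` to `Haar_{U(n)}`

statement-level skeleton of published theorems with citation tags; proofs where landed; nothing here is a claim
about the Yang–Mills mass gap

Mega-formalization `lit-balaban` (HOME `run/shared/lean/pub/lit-balaban/`), unit `lit-balaban-p28` gen 15 (Phase-2 proof
seat, free-target protocol G.5-34(d)): FILE 9, the last, of the discharge of the tree's named fact
`Literature.RepresentationTheory.CompactGroups.weylIntegralFormula_unitary` ([BtD] IV (1.11), `G = U(n)`, pushforward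
form): **`map_conj_haarProbability_prod_withDensity_eq`** — the conjugation map `(g, t) ↦ g t g⁻¹` pushes
`Haar_{U(n)} ⊗ w·Haar_{Δ(n)}`, `w(t) = Π_i Π_{j≠i}|t_ii − t_jj|/n!`, forward to `Haar_{U(n)}` — LITERALLY the body of the
fact (the one-line discharge `weylIntegralFormula_unitary_holds` is appended to `WeylIntegralFormula.lean`).
Reduction to the class-function form of file 8 ([BtD] IV (1.11) with `f = 1_S`): for a Borel set `S ⊆ U(n)` the
conjugation mass `κ_S(u) = Haar{g : g u g⁻¹ ∈ S}` is a measurable class function (right invariance of Haar),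
`(conj)_*(Haar ⊗ w Haar_T)(S) = ∫_T w κ_S dt` (Tonelli) `= ∫_G κ_S dg` (file 8) `= Haar(S)` (conjugation invariance of
Haar + Tonelli).

0 named facts, 0 sorry.

## References
* Th. Bröcker, T. tom Dieck, *Representations of Compact Lie Groups*, GTM 98 (1985), Ch. IV (1.11) p. 163, I (5.11)
  p. 44 (held: `book:brockernd-representations-compact-lie-groups`, p0153). [BrockerTomDieck1985]
-/

noncomputable section

open MeasureTheory Set
open scoped ENNReal Matrix.Norms.L2Operator

namespace Literature.RepresentationTheory.CompactGroups.WeylIntegration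

open Literature.MathematicalPhysics.QuantumFieldTheory (haarProbability measurePreserving_conj)
open Literature.LinearAlgebra.Matrix (diagonalTorus)

variable {n : Type*} [Fintype n] [DecidableEq n]

/-- THE CONJUGATION MASS `κ_S(u) = Haar{g ∈ U(n) : g u g⁻¹ ∈ S}` (= `∫_G 1_S(g u g⁻¹) dg` of (1.11) with `f = 1_S`).
[cite: BrockerTomDieck1985, IV (1.11) p0153] -/
def conjMass (S : Set (Matrix.unitaryGroup n ℂ)) (u : Matrix.unitaryGroup n ℂ) : ℝ≥0∞ :=
  haarProbability (Matrix.unitaryGroup n ℂ) ((fun g : Matrix.unitaryGroup n ℂ => g * u * g⁻¹) ⁻¹' S)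

/-- The conjugation relation `{(g, u) : g u g⁻¹ ∈ S}` is measurable. [cite: BrockerTomDieck1985, IV (1.11) p0153] -/
theorem measurableSet_conjRel {S : Set (Matrix.unitaryGroup n ℂ)} (hS : MeasurableSet S) :
    MeasurableSet {p : Matrix.unitaryGroup n ℂ × Matrix.unitaryGroup n ℂ | p.1 * p.2 * p.1⁻¹ ∈ S} :=
  hS.preimage ((continuous_fst.mul continuous_snd).mul continuous_fst.inv).measurable

/-- `κ_S` is measurable (measurability of sections of a product-measurable set). [cite: BrockerTomDieck1985, IV (1.11) p0153] -/
theorem measurable_conjMass {S : Set (Matrix.unitaryGroup n ℂ)} (hS : MeasurableSet S) : Measurable (conjMass S) := by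
  have h := measurable_measure_prodMk_right (μ := haarProbability (Matrix.unitaryGroup n ℂ)) (measurableSet_conjRel hS)
  have hfun : conjMass S = fun u : Matrix.unitaryGroup n ℂ => haarProbability (Matrix.unitaryGroup n ℂ)
      ((fun g : Matrix.unitaryGroup n ℂ => (g, u)) ⁻¹'
        {p : Matrix.unitaryGroup n ℂ × Matrix.unitaryGroup n ℂ | p.1 * p.2 * p.1⁻¹ ∈ S}) := by
    funext u
    rfl
  rw [hfun]
  exact h

/-- **`κ_S` is a class function** (right invariance of Haar measure: `{g : g(huh⁻¹)g⁻¹ ∈ S} = {g : gug⁻¹ ∈ S}·h⁻¹`).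
[cite: BrockerTomDieck1985, IV (1.11) p0153] [cite: BrockerTomDieck1985, I (5.11) p0044] -/
theorem conjMass_conj (S : Set (Matrix.unitaryGroup n ℂ)) (h u : Matrix.unitaryGroup n ℂ) :
    conjMass S (h * u * h⁻¹) = conjMass S u := by
  unfold conjMass
  have hset : (fun g : Matrix.unitaryGroup n ℂ => g * (h * u * h⁻¹) * g⁻¹) ⁻¹' S =
      (fun g : Matrix.unitaryGroup n ℂ => g * h) ⁻¹' ((fun g : Matrix.unitaryGroup n ℂ => g * u * g⁻¹) ⁻¹' S) := by
    ext g
    simp only [Set.mem_preimage, _root_.mul_inv_rev, mul_assoc]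
  rw [hset, measure_preimage_mul_right]

/-- **`∫_G κ_S dg = Haar(S)`** (Tonelli on `G × G` and conjugation invariance of Haar measure).
[cite: BrockerTomDieck1985, IV (1.11) p0153] [cite: BrockerTomDieck1985, I (5.11) p0044] -/
theorem lintegral_conjMass {S : Set (Matrix.unitaryGroup n ℂ)} (hS : MeasurableSet S) :
    ∫⁻ u, conjMass S u ∂haarProbability (Matrix.unitaryGroup n ℂ) = haarProbability (Matrix.unitaryGroup n ℂ) S := by
  set μ := haarProbability (Matrix.unitaryGroup n ℂ) with hμ
  have hE := measurableSet_conjRel hS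
  have h1 : (μ.prod μ) {p : Matrix.unitaryGroup n ℂ × Matrix.unitaryGroup n ℂ | p.1 * p.2 * p.1⁻¹ ∈ S} =
      ∫⁻ u, conjMass S u ∂μ := Measure.prod_apply_symm hE
  have h2 := Measure.prod_apply (μ := μ) (ν := μ) hE
  have h3 : ∀ g : Matrix.unitaryGroup n ℂ,
      μ ((fun u : Matrix.unitaryGroup n ℂ => (g, u)) ⁻¹'
        {p : Matrix.unitaryGroup n ℂ × Matrix.unitaryGroup n ℂ | p.1 * p.2 * p.1⁻¹ ∈ S}) = μ S := fun g =>
    (measurePreserving_conj g).measure_preimage hS.nullMeasurableSet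
  rw [← h1, h2]
  simp_rw [h3]
  rw [lintegral_const, measure_univ, mul_one]

/-- **WEYL'S INTEGRAL FORMULA FOR `U(n)`, PUSHFORWARD FORM** (the body of the tree's named fact
`weylIntegralFormula_unitary`): conjugation `(g, t) ↦ g t g⁻¹` maps `Haar_{U(n)} ⊗ (Π_iΠ_{j≠i}|t_ii − t_jj|/n!)·Haar_{Δ(n)}`
to `Haar_{U(n)}`. [cite: BrockerTomDieck1985, IV (1.11) p0153] -/
theorem map_conj_haarProbability_prod_withDensity_eq :
    Measure.map (fun q : Matrix.unitaryGroup n ℂ × diagonalTorus n =>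
        q.1 * (q.2 : Matrix.unitaryGroup n ℂ) * q.1⁻¹)
      ((haarProbability (Matrix.unitaryGroup n ℂ)).prod
        ((haarProbability (diagonalTorus n)).withDensity fun t => ENNReal.ofReal
          ((∏ i, ∏ j ∈ Finset.univ.erase i,
            ‖((t : Matrix.unitaryGroup n ℂ) : Matrix n n ℂ) i i -
              ((t : Matrix.unitaryGroup n ℂ) : Matrix n n ℂ) j j‖) / (Fintype.card n).factorial))) =
      haarProbability (Matrix.unitaryGroup n ℂ) := by
  have hw : (fun t : diagonalTorus n => ENNReal.ofReal
      ((∏ i, ∏ j ∈ Finset.univ.erase i,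
        ‖((t : Matrix.unitaryGroup n ℂ) : Matrix n n ℂ) i i -
          ((t : Matrix.unitaryGroup n ℂ) : Matrix n n ℂ) j j‖) / (Fintype.card n).factorial)) = weylWeight := rfl
  rw [hw]
  have hq : Measurable (fun q : Matrix.unitaryGroup n ℂ × diagonalTorus n => q.1 * (q.2 : Matrix.unitaryGroup n ℂ) * q.1⁻¹) :=
    ((continuous_fst.mul (continuous_subtype_val.comp continuous_snd)).mul continuous_fst.inv).measurable
  ext S hS
  rw [Measure.map_apply hq hS, Measure.prod_apply_symm (hq hS)]
  have hin : ∀ t : diagonalTorus n, haarProbability (Matrix.unitaryGroup n ℂ)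
      ((fun g : Matrix.unitaryGroup n ℂ => (g, t)) ⁻¹'
        ((fun q : Matrix.unitaryGroup n ℂ × diagonalTorus n => q.1 * (q.2 : Matrix.unitaryGroup n ℂ) * q.1⁻¹) ⁻¹' S)) =
      conjMass S (t : Matrix.unitaryGroup n ℂ) := fun t => rfl
  simp_rw [hin]
  have hκ : Measurable fun t : diagonalTorus n => conjMass S (t : Matrix.unitaryGroup n ℂ) :=
    (measurable_conjMass hS).comp measurable_subtype_coe
  rw [lintegral_withDensity_eq_lintegral_mul _ measurable_weylWeight hκ]
  change ∫⁻ t, weylWeight t * conjMass S (t : Matrix.unitaryGroup n ℂ) ∂haarProbability (diagonalTorus n) = _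
  rw [← lintegral_haarProbability_unitaryGroup_eq_lintegral_diagonalTorus (measurable_conjMass hS) (conjMass_conj S),
    lintegral_conjMass hS]

end Literature.RepresentationTheory.CompactGroups.WeylIntegration
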